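import Mathlib
import HarnessLib
import Summits.Ventures.LatticeQCDFlow.Scaling.AR1SwitchingLaw
import Summits.Ventures.LatticeQCDFlow.Scaling.NonEquilibriumOverhead

/-!
# ESSFloorCostEnvelope — reading rules for a CERTIFIED ESS floor `ÊSS(n) ≥ e^{−K/n}`: the floor
# constant of `GeneralLayerESSFloor` tends to the AR(1) model's `k′ = Δ²(1+ρ)/(1−ρ)` (sharp), the
# cost per effectively independent configuration is at most `(n + B)·e^{K/n}`, hence `≤ e·(K + B)`
# at `n = K`, and `n ≥ K/log(1/ε)` steps guarantee `ÊSS ≥ ε`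

HONEST FRAMING: exact (Metropolis-corrected) sampling algorithms for lattice gauge theory;
figures of merit are autocorrelation/cost numbers at stated couplings and volumes; no
continuum-physics claim.

Venture `LatticeQCDFlow` (cell pub-lqcd), topic `Scaling`; FANOUT row 19 (`su2-snf`, GEN-6).
OUR WORK, elementary real analysis; nothing is cited as a fact.  Context: the general-layer ESS
floor of this seat (`Scaling/GeneralLayerESSFloor`, staged behind the build lane at the time of
writing) certifies, for the uniform `n`-step switching protocol `S_c = S₀ + c·D` with arbitrary
positive Boltzmann-invariant layers that `χ²`-contract with `ρ`,
`ÊSS(n) ≥ exp(−K(ΔD/n)/n)` with the FLOOR CONSTANT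
`K(M) = (e^{M} + 2ρe^{3M}/(1 − ρe^{3M}))·σ̄²` (`floorConst ρ σ̄² M`), `M = ΔD/n`.  Gen-3's
`Scaling/NonEquilibriumOverhead` analysed the printed MODEL law `ESS(n) = e^{−c/n}` with the
per-evolution overhead `B` (cost `(n + B)·e^{c/n}` per effectively independent configuration).
This file turns the model statements into ONE-SIDED CERTIFIED statements under a floor:

* §1 THE FLOOR CONSTANT: `floorConst_zero` — `K(0) = ((1+ρ)/(1−ρ))·σ̄²`;
  **`floorConst_zero_eq_kPrime`** — with `σ̄² = Δ²`, `K(0) = kPrime Δ ρ`, the `k′ = Δ²·2τ_int` of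
  the exactly solvable AR(1) switching model (`Scaling/AR1SwitchingLaw`, where `−log ESS = k′N/n`
  holds WITH EQUALITY): the leading constant of the certified floor is attained, i.e. sharp;
  `floorConst_mono` — `K` is non-decreasing in `M` on `{ρe^{3M} < 1}` (so `K(ΔD/n)` DEcreases to
  `k′` as `n → ∞`, and one constant `K(ΔD/n₀)` serves every `n ≥ n₀`); `kPrime_le_floorConst`.
* §2 COST ENVELOPE: `cost_le_of_ess_floor` — `e^{−K/n} ≤ E` ⇒ `(n + B)/E ≤ (n + B)·e^{K/n}`
  (gen-3's model cost is an UPPER envelope of the true cost per effectively independent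
  configuration); `inv_ess_le_of_floor` — `1/E ≤ e^{K/n}` (relative variance of the Jarzynski
  weights `≤ e^{K/n} − 1`); `cost_at_floorConst_le` — at `n = K`: `(K + B)/E ≤ e·(K + B)`;
  `optimal_cost_le_of_ess_floor` — at gen-3's overhead optimum `m` (`m² = Km + KB`):
  `(m + B)/E ≤ e·(K + 2B)`.  The Eff-optimal cost with ANY such layers is `O(K + B)`, linear in
  `K ≈ 2τ̄·σ̄²` plus the overhead.
* §3 STEPS FOR A TARGET ESS: `le_of_ess_floor_of_steps` — if `n ≥ K/(−log ε)` (`0 < ε < 1`) then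
  `e^{−K/n} ≥ ε`, hence `ÊSS(n) ≥ ε`: the number of protocol steps needed for a prescribed ESS is
  at most `K/log(1/ε)`; with `K ≤ A·a^{−z}` in the lattice spacing this bounds the row's "exponent
  of cost versus `a` at fixed ESS" by `z` plus the sweep-cost exponent (reading only; no value of
  `z` is claimed).

NOT CLAIMED: the floor itself (that is `GeneralLayerESSFloor`); any value of `ρ`, `σ̄`, `ΔD`, `B`
for a lattice kernel; lower envelopes (those follow from GEN-5's ceiling, not from this file).
-/

namespace Summit.Ventures.LatticeQCDFlow.Scaling

open Real

/-! ## §1 The floor constant and its sharp limit -/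

/-- The FLOOR CONSTANT of the general-layer ESS floor as a function of `M = ΔD/n`:
`K(M) = (e^{M} + 2ρe^{3M}/(1 − ρe^{3M}))·s`, `s = σ̄²` (`ÊSS(n) ≥ exp(−K(ΔD/n)/n)`). -/
noncomputable def floorConst (ρ s M : ℝ) : ℝ :=
  (Real.exp M + 2 * (ρ * Real.exp (3 * M)) / (1 - ρ * Real.exp (3 * M))) * s

/-- `K(0) = ((1 + ρ)/(1 − ρ))·s` (`ρ ≠ 1`). -/
theorem floorConst_zero {ρ : ℝ} (hρ : ρ ≠ 1) (s : ℝ) :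
    floorConst ρ s 0 = (1 + ρ) / (1 - ρ) * s := by
  unfold floorConst
  have h1 : (1 : ℝ) - ρ ≠ 0 := sub_ne_zero.mpr (Ne.symm hρ)
  simp only [mul_zero, Real.exp_zero, mul_one]
  congr 1
  field_simp
  ring

/-- **Sharpness**: with `s = Δ²` the limit constant is the AR(1) model's `k′ = Δ²(1+ρ)/(1−ρ)
= Δ²·2τ_int` (`kPrime`, `kPrime_eq_tauInt`), for which `−log ESS = k′·N/n` holds with equality
(`Scaling/AR1SwitchingJarzynski`): the leading constant of the certified floor cannot be improved. -/
theorem floorConst_zero_eq_kPrime (Δ : ℝ) {ρ : ℝ} (hρ : ρ ≠ 1) :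
    floorConst ρ (Δ ^ 2) 0 = kPrime Δ ρ := by
  rw [floorConst_zero hρ, kPrime, mul_comm]

/-- `K` is non-decreasing in `M` on `{ρe^{3M'} < 1}` (`ρ, s ≥ 0`). -/
theorem floorConst_mono {ρ s M M' : ℝ} (hρ : 0 ≤ ρ) (hs : 0 ≤ s) (hMM' : M ≤ M')
    (hθ : ρ * Real.exp (3 * M') < 1) : floorConst ρ s M ≤ floorConst ρ s M' := by
  unfold floorConst
  refine mul_le_mul_of_nonneg_right ?_ hs
  have he : Real.exp M ≤ Real.exp M' := Real.exp_le_exp.mpr hMM'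
  have he3 : Real.exp (3 * M) ≤ Real.exp (3 * M') := Real.exp_le_exp.mpr (by linarith)
  have hθθ : ρ * Real.exp (3 * M) ≤ ρ * Real.exp (3 * M') := mul_le_mul_of_nonneg_left he3 hρ
  have hθ0 : 0 ≤ ρ * Real.exp (3 * M) := by positivity
  have h1 : 0 < 1 - ρ * Real.exp (3 * M') := by linarith
  have h1' : 0 < 1 - ρ * Real.exp (3 * M) := by linarith
  have hfrac : 2 * (ρ * Real.exp (3 * M)) / (1 - ρ * Real.exp (3 * M))
      ≤ 2 * (ρ * Real.exp (3 * M')) / (1 - ρ * Real.exp (3 * M')) := by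
    rw [div_le_div_iff₀ h1' h1]
    nlinarith [hθθ, hθ0]
  linarith

/-- In particular `k′ = K(0) ≤ K(M)` for `M ≥ 0`: the finite-`n` floor constant sits above its
sharp limit. -/
theorem kPrime_le_floorConst (Δ : ℝ) {ρ M : ℝ} (hρ : 0 ≤ ρ) (hM : 0 ≤ M)
    (hθ : ρ * Real.exp (3 * M) < 1) : kPrime Δ ρ ≤ floorConst ρ (Δ ^ 2) M := by
  have hρ1 : ρ ≠ 1 := by
    intro h
    rw [h, one_mul] at hθ
    have : (1 : ℝ) ≤ Real.exp (3 * M) := by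
      have := Real.add_one_le_exp (3 * M); linarith
    linarith
  rw [← floorConst_zero_eq_kPrime Δ hρ1]
  exact floorConst_mono hρ (sq_nonneg Δ) hM hθ

/-- `K` is continuous at `M = 0` when `ρ < 1`: `K(ΔD/n) → k′` as `n → ∞`. -/
theorem continuousAt_floorConst {ρ : ℝ} (hρ : ρ < 1) (s : ℝ) :
    ContinuousAt (floorConst ρ s) 0 := by
  unfold floorConst
  have h1 : (1 : ℝ) - ρ * Real.exp (3 * 0) ≠ 0 := by
    simp only [mul_zero, Real.exp_zero, mul_one]; exact sub_ne_zero.mpr (ne_of_gt hρ)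
  have hc : ContinuousAt (fun M : ℝ => 1 - ρ * Real.exp (3 * M)) 0 := by fun_prop
  have hnum : ContinuousAt (fun M : ℝ => 2 * (ρ * Real.exp (3 * M))) 0 := by fun_prop
  have hexp : ContinuousAt (fun M : ℝ => Real.exp M) 0 := by fun_prop
  exact ((hexp.add (hnum.div hc h1)).mul continuousAt_const)

/-! ## §2 The cost envelope under a floor -/

/-- **A floor on the ESS is a ceiling on the cost.**  If `e^{−K/n} ≤ E` (`E` the ESS fraction at
`n` steps, `n + B ≥ 0`), then the cost per effectively independent configuration obeys
`(n + B)/E ≤ (n + B)·e^{K/n}` — gen-3's model cost, read as an upper envelope. -/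
theorem cost_le_of_ess_floor {K B n E : ℝ} (hnB : 0 ≤ n + B) (hE : Real.exp (-(K / n)) ≤ E) :
    (n + B) / E ≤ (n + B) * Real.exp (K / n) := by
  have hE0 : 0 < E := lt_of_lt_of_le (Real.exp_pos _) hE
  rw [div_le_iff₀ hE0]
  have h : (n + B) * 1 ≤ (n + B) * (Real.exp (K / n) * E) := by
    refine mul_le_mul_of_nonneg_left ?_ hnB
    have := mul_le_mul_of_nonneg_left hE (Real.exp_pos (K / n)).le
    rwa [← Real.exp_add, add_neg_cancel, Real.exp_zero] at this
  linarith

/-- **Relative second moment of the Jarzynski weights**: `1/E ≤ e^{K/n}`, i.e. the per-evolution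
relative variance `E[w²]/E[w]² − 1 = 1/ÊSS − 1` of the reweighting estimator of `Z_1/Z_0` is at most
`e^{K/n} − 1`. -/
theorem inv_ess_le_of_floor {K n E : ℝ} (hE : Real.exp (-(K / n)) ≤ E) :
    1 / E ≤ Real.exp (K / n) := by
  have hE0 : 0 < E := lt_of_lt_of_le (Real.exp_pos _) hE
  rw [div_le_iff₀ hE0]
  have := mul_le_mul_of_nonneg_left hE (Real.exp_pos (K / n)).le
  rwa [← Real.exp_add, add_neg_cancel, Real.exp_zero] at this

/-- **At `n = K` the cost is at most `e·(K + B)`** (`K > 0`, `B ≥ 0`). -/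
theorem cost_at_floorConst_le {K B E : ℝ} (hK : 0 < K) (hB : 0 ≤ B)
    (hE : Real.exp (-(K / K)) ≤ E) : (K + B) / E ≤ Real.exp 1 * (K + B) := by
  have hKB : 0 ≤ K + B := by linarith
  have h := cost_le_of_ess_floor (n := K) hKB hE
  rwa [div_self hK.ne', mul_comm] at h

/-- **At gen-3's overhead optimum the cost is at most `e·(K + 2B)`**: for `m > 0` with
`m² = K·m + K·B` and `e^{−K/m} ≤ E`, `(m + B)/E ≤ e·(K + 2B)`
(`NonEquilibriumOverhead.overhead_optimum_cost_le` composed with the envelope). -/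
theorem optimal_cost_le_of_ess_floor {K B m E : ℝ} (hK : 0 < K) (hB : 0 ≤ B) (hm : 0 < m)
    (hq : m ^ 2 = K * m + K * B) (hE : Real.exp (-(K / m)) ≤ E) :
    (m + B) / E ≤ Real.exp 1 * (K + 2 * B) :=
  (cost_le_of_ess_floor (by linarith) hE).trans (overhead_optimum_cost_le hK hB hm hq)

-- (The envelope is never below gen-3's universal floor `e·K + B`: that is exactly the landed
-- `NonEquilibriumOverhead.overhead_cost_ge_linear` / `overhead_optimum_cost_ge` — not restated here.)

/-! ## §3 Steps for a target ESS -/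

/-- **`n ≥ K/log(1/ε)` steps suffice for `e^{−K/n} ≥ ε`** (`0 < ε < 1`, `n > 0`). -/
theorem le_exp_neg_div_of_steps {K n ε : ℝ} (hε0 : 0 < ε) (hε1 : ε < 1) (hn : 0 < n)
    (hsteps : K / (-Real.log ε) ≤ n) : ε ≤ Real.exp (-(K / n)) := by
  have hlog : 0 < -Real.log ε := by
    have := Real.log_neg hε0 hε1; linarith
  have hKn : K ≤ n * (-Real.log ε) := by
    rwa [div_le_iff₀ hlog] at hsteps
  have h1 : Real.log ε ≤ -(K / n) := by
    have : K / n ≤ -Real.log ε := by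
      rw [div_le_iff₀ hn]; linarith
    linarith
  calc ε = Real.exp (Real.log ε) := (Real.exp_log hε0).symm
    _ ≤ Real.exp (-(K / n)) := Real.exp_le_exp.mpr h1

/-- **Steps for a target ESS under a certified floor**: if `e^{−K/n} ≤ E(n)` and
`n ≥ K/log(1/ε)`, then `E(n) ≥ ε`. -/
theorem le_of_ess_floor_of_steps {K n ε E : ℝ} (hε0 : 0 < ε) (hε1 : ε < 1)
    (hn : 0 < n) (hsteps : K / (-Real.log ε) ≤ n) (hE : Real.exp (-(K / n)) ≤ E) : ε ≤ E :=
  (le_exp_neg_div_of_steps hε0 hε1 hn hsteps).trans hE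

/-- The floor constant serves every larger `n`: if `K(M₀)` is the constant at `M₀ = ΔD/n₀` then for
`M = ΔD/n ≤ M₀` (i.e. `n ≥ n₀`), `e^{−K(M₀)/n} ≤ e^{−K(M)/n}` — one number `K = K(ΔD/n₀)` gives
`ÊSS(n) ≥ e^{−K/n}` uniformly in `n ≥ n₀` (`n > 0`, `ρ, s ≥ 0`, `ρe^{3M₀} < 1`). -/
theorem exp_neg_floorConst_div_mono {ρ s M M₀ n : ℝ} (hρ : 0 ≤ ρ) (hs : 0 ≤ s) (hM : M ≤ M₀)
    (hθ : ρ * Real.exp (3 * M₀) < 1) (hn : 0 < n) :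
    Real.exp (-(floorConst ρ s M₀ / n)) ≤ Real.exp (-(floorConst ρ s M / n)) := by
  have h := floorConst_mono hρ hs hM hθ
  exact Real.exp_le_exp.mpr (neg_le_neg (div_le_div_of_nonneg_right h hn.le))

end Summit.Ventures.LatticeQCDFlow.Scaling
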